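import Mathlib.Analysis.Complex.RemovableSingularity
import Literature.NumberTheory.LFunctions.RayClassPartialZetaUnfold
import Literature.NumberTheory.LFunctions.HeckeThetaContinuation
import Literature.NumberTheory.LFunctions.RayClassOrthogonality
import HarnessLib

/-!
# The partial zeta functions of narrow ray classes: entire part and common residue

Topic `Literature/NumberTheory/LFunctions`; namespace `Literature.NumberTheory.LFunctions`.  Pure-proof
companion of `RayClassPartialZetaUnfold.lean`, `HeckeThetaContinuation.lean` (Hecke's continuation of the
partial zeta functions `Z_𝔪(𝔟, s)` of the narrow ray classes `mod 𝔪`, Neukirch VII (8.5) with Remark 1) and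
`RayClassOrthogonality.lean`.  Everything here is PROVED (D-0014/D-0026: no named fact and no definition is
introduced); the file sharpens the tree's `rayClassPartialZeta_hasMeromorphicContinuation_holds`
("meromorphic, holomorphic off `{0, 1}`") to the form in which Hecke's theorem is used for non-principal
characters (Neukirch VII §5 p. 473 and (5.11); §8 (8.5)–(8.6) with Remark 1; §10 proof of (10.6)) — the
analytic input of Artin's conjecture in degree one (`Automorphic/ArtinLFunctionsAbelianRayClassProofs.lean`,
hypothesis `hZ` of `artinLFunction_hasEntireContinuation_of_rank_one_of_artinReciprocity_of_partialZeta`):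

* `NumberField.exists_entire_signedCosetSum_eq_add_div` — for the signed coset series
  `D_p(s) = Σ_{x ∈ ℜ} sgn N(x^p) |N(x)|^{-s}` of a coset `a₀ + 𝔞` (`signedCosetSum`): `D_p(s) = E_p(s) + R_p/(s-1)`
  on `Re(s) > 1` with `E_p` ENTIRE and `R_p = 2 ε g₀ · c_N⁻¹ A_p(1/2)⁻¹` (`ε`, `g₀ = 𝟙[p = ∅]` the constants of
  the weak FE-pair `heckePairW`, Neukirch VII (8.4)–(8.5)): the Mellin principle (VII (1.4), Mathlib
  `WeakFEPair.Λ = Λ₀ - f₀/s' - ε g₀/(k - s')`, `k = 1/2`, `s' = s/2`) exhibits the only possible poles `s = 0`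
  (killed by the zero of `A_p(s/2)⁻¹ = ∏ … Γ(e_w s/2 + p_w/2)⁻¹` when `f₀ ≠ 0`, i.e. `p = ∅`) and `s = 1`;
* `exists_rayClassPartialZeta_eq_add_div` — **Neukirch VII (5.11) for narrow ray classes**: for `𝔪 ≠ 0`
  there is ONE `ρ = ρ_𝔪 ∈ ℂ` such that every partial zeta function satisfies
  `Z_𝔪(𝔟, s) = Z₀^𝔟(s) + ρ/(s-1)` on `Re(s) > 1` with `Z₀^𝔟` entire (via
  `rayClassPartialZeta_eq_sum_pieceDirichlet`: `Z_𝔪(𝔟,s) = h⁻¹ 2^{-r₁} 𝔑(𝔟)^{-s} Σ_p D_p(s)` for the coset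
  `1 + 𝔪𝔟⁻¹`; the residue `h⁻¹ 2^{1-r₁} c_N⁻¹ A_∅(1/2)⁻¹ /(𝔑(𝔪)√|d_K|)` does not depend on `𝔟` because
  `𝔑(𝔪𝔟⁻¹) = 𝔑(𝔪)/𝔑(𝔟)` and the multiplicity `h = rayMult` is the number of box representatives of the
  ray units, `rayMult_eq_natCard`);
* `exists_differentiable_eq_rayClassLSeries` — **Hecke: `L(χ, s)` is entire for every non-principal ray
  class character `χ mod 𝔪`** (with the orthogonality argument of `RayClassOrthogonality.lean`,
  Neukirch VII §5 p. 473: "If `χ ≠ 1`, then `Z(χ,s)` is holomorphic on all of `ℂ`, as `Σ_𝔎 χ(𝔎) = 0`").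
  (The weaker regularity at `s = 1`, `rayClassLSeries_tendsto_nhdsGT_one_holds`, is proved independently in
  `RayClassLSeriesAtOneLimitProofs.lean` by Weber's estimate and partial summation.)

## References

* J. Neukirch, *Algebraic Number Theory*, Grundlehren 322, Springer 1999, Ch. VII §1 (1.4), §5 (5.9)–(5.11) and
  p. 473, §8 (8.3)–(8.6) with Remark 1. [NeukirchANT1999]
* E. Hecke, *Über eine neue Anwendung der Zetafunktionen auf die Arithmetik der Zahlkörper*, Nachr. Ges. Wiss.
  Göttingen (1917), 90–95. [Hecke1917]
-/

noncomputable section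

open Complex NumberField NumberField.InfinitePlace NumberField.Units IsDedekindDomain
open scoped NumberField nonZeroDivisors

namespace Literature.NumberTheory.LFunctions

variable {K : Type*} [Field K] [NumberField K]

/-! ### Divided differences of entire functions -/

/-- The divided difference `dslope G a` of an entire function is entire (removable singularity; a private
copy of `BurnolVectors.differentiable_dslope` of `NymanBeurlingVectorsOrthogonal.lean`, which this file does not
import). [folklore] -/
private theorem differentiable_dslope_of_entire {G : ℂ → ℂ} (hG : Differentiable ℂ G) (a : ℂ) :
    Differentiable ℂ (dslope G a) :=
  differentiableOn_univ.mp ((Complex.differentiableOn_dslope Filter.univ_mem).mpr hG.differentiableOn)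

/-! ### The multiplicity `h = rayMult` does not depend on the class -/

open scoped Classical in
/-- **The multiplicity `h(𝔪, 𝔟, N)` is the number of box representatives of the ray units**: the
representatives of the ideal `𝔟` itself among `rayReps 𝔪 𝔟 N` are exactly the units `u ≡ 1 mod 𝔪`,
`u ≫ 0` (`narrowRayUnits 𝔪`) whose cone exponent lies in the box `[0,N)^{r-1}`; in particular `h` does not
depend on `𝔟` (it is the index `(𝒪_+^𝔪 : V)`). [folklore] -/
theorem rayMult_eq_natCard {𝔪 𝔟 : Ideal (𝓞 K)} (h𝔟 : 𝔟 ≠ ⊥) (hcop : IsCoprime 𝔟 𝔪) (N : ℕ) :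
    rayMult h𝔟 hcop N =
      Nat.card {x : K // (∃ u : (𝓞 K)ˣ, u ∈ narrowRayUnits 𝔪 ∧ ((u : 𝓞 K) : K) = x) ∧ InConeBox N x} := by
  have h1 : (1 : K) ∈ rayElts 𝔪 𝔟 := one_mem_rayElts 𝔪 𝔟
  have hid1 : rayEltIdeal h𝔟 h1.2.1 = 𝔟 := by
    refine (FractionalIdeal.coeIdeal_inj (K := K)).mp ?_
    rw [coe_rayEltIdeal, FractionalIdeal.spanSingleton_one, one_mul]
  -- membership of a unit of the narrow ray in `rayElts`, and its ideal
  have hmemu : ∀ u : (𝓞 K)ˣ, u ∈ narrowRayUnits 𝔪 → ((u : 𝓞 K) : K) ∈ rayElts 𝔪 𝔟 := fun u hu ↦ by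
    simpa only [mul_one] using unit_mul_mem_rayElts h𝔟 hu h1
  have hidu : ∀ (u : (𝓞 K)ˣ) (hu : u ∈ narrowRayUnits 𝔪),
      rayEltIdeal h𝔟 (hmemu u hu).2.1 = 𝔟 := fun u hu ↦ by
    have hux : ((u : 𝓞 K) : K) * 1 - 1 ∈ rayModulus K 𝔪 𝔟 := (unit_mul_mem_rayElts h𝔟 hu h1).2.1
    rw [rayEltIdeal_congr h𝔟 (hmemu u hu).2.1 hux (mul_one _).symm, rayEltIdeal_unit_mul h𝔟 u h1.2.1 hux,
      hid1]
  unfold rayMult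
  refine Nat.card_congr
    { toFun := fun y ↦ ⟨(y.1 : K), ?_, y.1.2.2⟩
      invFun := fun x ↦ ⟨⟨x.1, ?_, x.2.2⟩, ?_⟩
      left_inv := fun y ↦ Subtype.ext (Subtype.ext rfl)
      right_inv := fun x ↦ Subtype.ext rfl }
  · -- a representative of `𝔟` is a unit of the narrow ray
    have hy : repIdeal h𝔟 hcop N y.1 = ⟨𝔟, RayClassRel.refl 𝔪 𝔟⟩ := y.2
    have hid : rayEltIdeal h𝔟 h1.2.1 = rayEltIdeal h𝔟 y.1.2.1.2.1 := by
      rw [hid1]; exact (congrArg Subtype.val hy).symm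
    obtain ⟨u, hu, hxu⟩ := exists_rayUnit_of_rayEltIdeal_eq h𝔟 hcop h1 y.1.2.1 hid
    exact ⟨u, hu, by rw [hxu, mul_one]⟩
  · -- a box unit of the narrow ray is a representative …
    obtain ⟨u, hu, hux⟩ := x.2.1
    rw [← hux]
    exact hmemu u hu
  · -- … of the ideal `𝔟`
    obtain ⟨u, hu, hux⟩ := x.2.1
    have hx1 : x.1 - 1 ∈ rayModulus K 𝔪 𝔟 := by rw [← hux]; exact (hmemu u hu).2.1
    show repIdeal h𝔟 hcop N _ = _
    refine Subtype.ext ?_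
    simp only [repIdeal]
    rw [rayEltIdeal_congr h𝔟 hx1 (hmemu u hu).2.1 hux.symm, hidu u hu]

/-- **`h(𝔪, 𝔟, N) = h(𝔪, 𝔟', N)`**: the multiplicity is the same for all classes. [folklore] -/
theorem rayMult_eq_rayMult {𝔪 𝔟 𝔟' : Ideal (𝓞 K)} (h𝔟 : 𝔟 ≠ ⊥) (hcop : IsCoprime 𝔟 𝔪) (h𝔟' : 𝔟' ≠ ⊥)
    (hcop' : IsCoprime 𝔟' 𝔪) (N : ℕ) : rayMult h𝔟 hcop N = rayMult h𝔟' hcop' N := by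
  rw [rayMult_eq_natCard, rayMult_eq_natCard]

/-! ### The signed coset series: entire part and polar part at `s = 1` -/

namespace NumberField

open scoped Classical

/-- `A_∅(0) = 0` in Mathlib's convention `Γ(0) = 0`: every factor of `A_∅(z) = ∏_w (π e_w)^{-e_w z} Γ(e_w z)` is
`Γ(0) = 0` at `z = 0` (analytically: `A_∅⁻¹` vanishes at `0`). [folklore] -/
theorem gammaFactorCP_empty_zero : gammaFactorCP K ∅ 0 = 0 := by
  obtain ⟨w₀⟩ := (inferInstance : Nonempty (InfinitePlace K))
  unfold gammaFactorCP
  refine Finset.prod_eq_zero (Finset.mem_univ w₀) ?_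
  have hw : halfWeight K ∅ w₀ = 0 := by
    unfold halfWeight; split_ifs <;> simp_all
  rw [hw, Complex.ofReal_zero, mul_zero, zero_add, Complex.Gamma_zero, mul_zero]

/-- **The signed coset series: entire part and polar part** (Neukirch VII (8.5) via the Mellin principle
(1.4), in Mathlib's form `Λ = Λ₀ - f₀/s' - ε g₀/(k - s')`).  For a nonzero fractional ideal `𝔞`, a shift
`a₀`, an even `N ≠ 0` with `(u_i^N - 1)a₀ ∈ 𝔞` and a set `p` of real places, there is an ENTIRE `E` with
`D_p(s) = E(s) + 2 ε g₀ c_N⁻¹ A_p(1/2)⁻¹ / (s - 1)` for `Re(s) > 1`, where `ε = (-i)^{|p|}(𝔑(𝔞)√|d_K|)⁻¹` and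
`g₀ = 𝟙[p = ∅]` are the constants of the weak FE-pair `P = heckePairW K p 𝔞 a₀ N` (VII (8.4)): from
`D_p(s) = c_N⁻¹ A_p(s/2)⁻¹ Λ_P(s/2)` (`heckePairW_Λ_eq_signedCosetSum`) and
`Λ_P(s/2) = Λ₀(s/2) - 2f₀/s - 2εg₀/(1-s)` with `Λ₀`, `A_p⁻¹` entire; the term `A_p(s/2)⁻¹ f₀/s` is entire
because `f₀ = 𝟙[p = ∅ ∧ a₀ ∈ 𝔞]` vanishes unless `p = ∅`, and `A_∅(s/2)⁻¹` vanishes at `s = 0`.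
[cite: NeukirchANT1999, Ch. VII §1 (1.4) Theorem and §8 (8.5) Theorem] -/
theorem exists_entire_signedCosetSum_eq_add_div (p : Finset {w : InfinitePlace K // IsReal w})
    (I : (FractionalIdeal (𝓞 K)⁰ K)ˣ) (a₀ : K) {N : ℕ} (hN0 : N ≠ 0) (hN : Even N)
    (hV : ∀ i, (((fundSystem K i : (𝓞 K)ˣ) : K) ^ N - 1) * a₀ ∈ (I : FractionalIdeal (𝓞 K)⁰ K)) :
    ∃ E : ℂ → ℂ, Differentiable ℂ E ∧ ∀ s : ℂ, 1 < s.re →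
      signedCosetSum K p (I : FractionalIdeal (𝓞 K)⁰ K) a₀ N s =
        E s + 2 * (heckePairW K p I a₀ N).ε * (heckePairW K p I a₀ N).g₀ *
          ((((pieceCst K N : ℝ) : ℂ))⁻¹ * (gammaFactorCP K p (1 / 2))⁻¹) / (s - 1) := by
  set P := heckePairW K p I a₀ N with hP
  have hc0 : ((pieceCst K N : ℝ) : ℂ) ≠ 0 := Complex.ofReal_ne_zero.mpr (pieceCst_pos hN0).ne'
  set G : ℂ → ℂ := fun s ↦ (((pieceCst K N : ℝ) : ℂ))⁻¹ * (gammaFactorCP K p (s / 2))⁻¹ with hG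
  have hGd : Differentiable ℂ G :=
    (differentiable_const _).mul ((differentiable_inv_gammaFactorCP p).comp (differentiable_id.div_const 2))
  -- `f₀ · G(0) = 0`: either `p ≠ ∅` and `f₀ = 0`, or `p = ∅` and `A_∅(0)⁻¹ = 0`
  have hf0G : P.f₀ * G 0 = 0 := by
    by_cases hp : p = ∅
    · subst hp
      have : G 0 = 0 := by simp only [hG, zero_div, gammaFactorCP_empty_zero, inv_zero, mul_zero]
      rw [this, mul_zero]
    · have : P.f₀ = 0 := by
        show heckeThetaConst K p (I : FractionalIdeal (𝓞 K)⁰ K) a₀ = 0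
        simp [heckeThetaConst, hp]
      rw [this, zero_mul]
  refine ⟨fun s ↦ G s * P.Λ₀ (s / 2) - 2 * (P.f₀ * dslope G 0 s) + 2 * P.ε * P.g₀ * dslope G 1 s, ?_,
    fun s hs ↦ ?_⟩
  · have hΛ : Differentiable ℂ (fun s : ℂ ↦ P.Λ₀ (s / 2)) := P.differentiable_Λ₀.comp (differentiable_id.div_const 2)
    exact ((hGd.mul hΛ).sub ((differentiable_const _).mul ((differentiable_const _).mul
      (differentiable_dslope_of_entire hGd 0)))).add
      ((differentiable_const _).mul (differentiable_dslope_of_entire hGd 1))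
  · have hs0 : s ≠ 0 := fun h ↦ by rw [h, Complex.zero_re] at hs; linarith
    have hs1 : s ≠ 1 := fun h ↦ by rw [h, Complex.one_re] at hs; linarith
    have hs1' : s - 1 ≠ 0 := sub_ne_zero.mpr hs1
    have hs12 : (1 : ℂ) / 2 - s / 2 ≠ 0 := fun h ↦ hs1 (by linear_combination -2 * h)
    have hs' : 0 < (s / 2).re := by simp only [Complex.div_ofNat_re]; linarith
    have hA0 := gammaFactorCP_ne_zero p hs'
    -- `D_p(s) = G(s) Λ_P(s/2)`
    have hD : signedCosetSum K p (I : FractionalIdeal (𝓞 K)⁰ K) a₀ N s = G s * P.Λ (s / 2) := by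
      rw [hP, heckePairW_Λ_eq_signedCosetSum p I a₀ hN0 hN hV hs, hG]
      field_simp
    -- `Λ_P(s/2) = Λ₀(s/2) - f₀/(s/2) - ε g₀/(1/2 - s/2)`
    have hΛ : P.Λ (s / 2) = P.Λ₀ (s / 2) - (1 / (s / 2)) * P.f₀ - (P.ε / ((P.k : ℂ) - s / 2)) * P.g₀ := by
      simp only [WeakFEPair.Λ, smul_eq_mul]
    have hk : ((P.k : ℝ) : ℂ) = 1 / 2 := by
      rw [show P.k = 1 / 2 from rfl]; push_cast; ring
    have h0 : P.f₀ * dslope G 0 s = P.f₀ * G s / s := by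
      rw [dslope_of_ne _ hs0, slope_def_field, sub_zero, mul_div_assoc', mul_sub, hf0G, sub_zero]
    have h1 : dslope G 1 s = (G s - G 1) / (s - 1) := by
      rw [dslope_of_ne _ hs1, slope_def_field]
    have hG1 : G 1 = (((pieceCst K N : ℝ) : ℂ))⁻¹ * (gammaFactorCP K p (1 / 2))⁻¹ := rfl
    rw [hD, hΛ, hk]
    dsimp only
    rw [h0, h1, ← hG1]
    field_simp
    ring

/-- **Summing over the sign characters**: `Σ_p D_p(s) = E(s) + 2 ε_∅ c_N⁻¹ A_∅(1/2)⁻¹/(s-1)` on `Re(s) > 1`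
with `E` entire — only `p = ∅` (`g₀ = 1`) contributes a pole. [cite: NeukirchANT1999, Ch. VII §8 (8.5) Theorem] -/
theorem exists_entire_sum_signedCosetSum_eq_add_div (I : (FractionalIdeal (𝓞 K)⁰ K)ˣ) (a₀ : K) {N : ℕ}
    (hN0 : N ≠ 0) (hN : Even N)
    (hV : ∀ i, (((fundSystem K i : (𝓞 K)ˣ) : K) ^ N - 1) * a₀ ∈ (I : FractionalIdeal (𝓞 K)⁰ K)) :
    ∃ E : ℂ → ℂ, Differentiable ℂ E ∧ ∀ s : ℂ, 1 < s.re →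
      ∑ p : Finset {w : InfinitePlace K // IsReal w}, signedCosetSum K p (I : FractionalIdeal (𝓞 K)⁰ K) a₀ N s =
        E s + 2 * (heckePairW K ∅ I a₀ N).ε *
          ((((pieceCst K N : ℝ) : ℂ))⁻¹ * (gammaFactorCP K ∅ (1 / 2))⁻¹) / (s - 1) := by
  choose E hEd hEs using fun p : Finset {w : InfinitePlace K // IsReal w} ↦
    exists_entire_signedCosetSum_eq_add_div p I a₀ hN0 hN hV
  refine ⟨fun s ↦ ∑ p, E p s, Differentiable.fun_sum fun p _ ↦ hEd p, fun s hs ↦ ?_⟩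
  have hres : ∑ p : Finset {w : InfinitePlace K // IsReal w}, 2 * (heckePairW K p I a₀ N).ε *
      (heckePairW K p I a₀ N).g₀ * ((((pieceCst K N : ℝ) : ℂ))⁻¹ * (gammaFactorCP K p (1 / 2))⁻¹) =
      2 * (heckePairW K ∅ I a₀ N).ε * ((((pieceCst K N : ℝ) : ℂ))⁻¹ * (gammaFactorCP K ∅ (1 / 2))⁻¹) := by
    rw [Finset.sum_eq_single (∅ : Finset {w : InfinitePlace K // IsReal w})]
    · have hg : (heckePairW K ∅ I a₀ N).g₀ = 1 := by
        show (if (∅ : Finset {w : InfinitePlace K // IsReal w}) = ∅ then (1 : ℂ) else 0) = 1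
        exact if_pos rfl
      rw [hg, mul_one]
    · intro p _ hp
      have hg : (heckePairW K p I a₀ N).g₀ = 0 := by
        show (if p = ∅ then (1 : ℂ) else 0) = 0
        exact if_neg hp
      rw [hg, mul_zero, zero_mul]
    · exact fun h ↦ absurd (Finset.mem_univ _) h
  rw [Finset.sum_congr rfl fun p _ ↦ hEs p s hs, Finset.sum_add_distrib, ← Finset.sum_div, hres]

end NumberField

/-! ### Neukirch VII (5.11) for narrow ray classes: `Z_𝔪(𝔟, s) = Z₀^𝔟(s) + ρ_𝔪/(s-1)` -/

/-- **The partial zeta functions of the narrow ray classes `mod 𝔪` are entire up to a simple pole at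
`s = 1` with a common residue** (Neukirch VII (5.11) (i)–(ii) for `𝔪 = 1`: "`Z(𝔎, s)` … simple pole at
`s = 1` with residue `2^{r₁}(2π)^{r₂}R/(w√|d_K|)`", independent of the class; §8 Remark 1 after (8.6) for
ray classes: "proceed exactly as for the Dedekind zeta function"; Hecke 1917).  For `𝔪 ≠ 0` there is
`ρ ∈ ℂ` such that for every nonzero integral `𝔟` prime to `𝔪` there is an entire `Z₀` with
`Z_𝔪(𝔟, s) = Z₀(s) + ρ/(s-1)` for `Re(s) > 1`.  Proof: `Z_𝔪(𝔟, s) = h⁻¹ 2^{-r₁} 𝔑(𝔟)^{-s} Σ_p D_p(s)` for the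
coset `1 + 𝔪𝔟⁻¹` (`rayClassPartialZeta_eq_sum_pieceDirichlet`), `Σ_p D_p = E + 2ε_∅c_N⁻¹A_∅(1/2)⁻¹/(s-1)`
(`exists_entire_sum_signedCosetSum_eq_add_div`), `ε_∅ = (𝔑(𝔪𝔟⁻¹)√|d_K|)⁻¹ = 𝔑(𝔟)(𝔑(𝔪)√|d_K|)⁻¹`, and
`h = rayMult` is independent of `𝔟` (`rayMult_eq_natCard`), so that
`ρ = h⁻¹ 2^{1-r₁} c_N⁻¹ A_∅(1/2)⁻¹ (𝔑(𝔪)√|d_K|)⁻¹`.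
[cite: NeukirchANT1999, Ch. VII §5 Cor. (5.11) and §8 Thm. (8.5) with Remark 1 (after (8.6))] -/
theorem exists_rayClassPartialZeta_eq_add_div {𝔪 : Ideal (𝓞 K)} (h𝔪 : 𝔪 ≠ ⊥) :
    ∃ ρ : ℂ, ∀ 𝔟 : Ideal (𝓞 K), 𝔟 ≠ ⊥ → IsCoprime 𝔟 𝔪 →
      ∃ Z₀ : ℂ → ℂ, Differentiable ℂ Z₀ ∧
        ∀ s : ℂ, 1 < s.re → rayClassPartialZeta 𝔪 𝔟 s = Z₀ s + ρ / (s - 1) := by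
  classical
  obtain ⟨N, hN0, hN, hNu⟩ := exists_even_pow_sub_one_mem (K := K) h𝔪
  have hNm : ∀ i, ((fundSystem K i : (𝓞 K)ˣ) : 𝓞 K) ^ N - 1 ∈ 𝔪 := fun i ↦ hNu _
  -- the `𝔟`-independent multiplicity
  set h₀ : ℕ := Nat.card {x : K // (∃ u : (𝓞 K)ˣ, u ∈ narrowRayUnits 𝔪 ∧ ((u : 𝓞 K) : K) = x) ∧
    InConeBox N x} with hh₀
  refine ⟨((h₀ : ℂ))⁻¹ * ((2 : ℂ) ^ Fintype.card {w : InfinitePlace K // IsReal w})⁻¹ *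
      (2 * ((((Ideal.absNorm 𝔪 : ℝ) * Real.sqrt |(discr K : ℝ)|)⁻¹ : ℝ) : ℂ) *
        ((((NumberField.pieceCst K N : ℝ) : ℂ))⁻¹ * (NumberField.gammaFactorCP K ∅ (1 / 2))⁻¹)),
    fun 𝔟 h𝔟 hcop ↦ ?_⟩
  -- the coset `1 + 𝔪𝔟⁻¹`
  set I : (FractionalIdeal (𝓞 K)⁰ K)ˣ := Units.mk0 (rayModulus K 𝔪 𝔟) (rayModulus_ne_zero h𝔪 h𝔟) with hI
  have hIc : (I : FractionalIdeal (𝓞 K)⁰ K) = rayModulus K 𝔪 𝔟 := rfl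
  have hV : ∀ i, (((fundSystem K i : (𝓞 K)ˣ) : K) ^ N - 1) * 1 ∈ (I : FractionalIdeal (𝓞 K)⁰ K) := by
    intro i
    rw [mul_one, hIc]
    have := coeIdeal_le_rayModulus 𝔪 h𝔟 (FractionalIdeal.mem_coeIdeal_of_mem (𝓞 K)⁰ (hNm i))
    rwa [map_sub, map_pow, map_one] at this
  obtain ⟨E, hEd, hEs⟩ := NumberField.exists_entire_sum_signedCosetSum_eq_add_div I 1 hN0 hN hV
  set R : ℂ := 2 * (NumberField.heckePairW K ∅ I 1 N).ε *
    ((((NumberField.pieceCst K N : ℝ) : ℂ))⁻¹ * (NumberField.gammaFactorCP K ∅ (1 / 2))⁻¹) with hR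
  -- the factor `C(s) = h⁻¹ 2^{-r₁} 𝔑(𝔟)^{-s}`
  have hNb : ((Ideal.absNorm 𝔟 : ℕ) : ℂ) ≠ 0 := by
    have : (0 : ℝ) < Ideal.absNorm 𝔟 := by
      exact_mod_cast Nat.pos_of_ne_zero (by rwa [ne_eq, Ideal.absNorm_eq_zero_iff])
    exact_mod_cast this.ne'
  set C : ℂ → ℂ := fun s ↦ ((rayMult h𝔟 hcop N : ℂ))⁻¹ *
    ((2 : ℂ) ^ Fintype.card {w : InfinitePlace K // IsReal w})⁻¹ * ((Ideal.absNorm 𝔟 : ℕ) : ℂ) ^ (-s) with hC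
  have hCd : Differentiable ℂ C := by
    rw [hC]
    exact (differentiable_const _).mul (differentiable_id.neg.const_cpow (Or.inl hNb))
  refine ⟨fun s ↦ C s * E s + R * dslope C 1 s,
    (hCd.mul hEd).add ((differentiable_const _).mul (differentiable_dslope_of_entire hCd 1)), fun s hs ↦ ?_⟩
  have hs1 : s ≠ 1 := fun h ↦ by rw [h, Complex.one_re] at hs; linarith
  have hs1' : s - 1 ≠ 0 := sub_ne_zero.mpr hs1
  -- the residue `C(1) R` is the proposed `ρ`
  have hmult : rayMult h𝔟 hcop N = h₀ := rayMult_eq_natCard h𝔟 hcop N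
  have hh0 : (h₀ : ℂ) ≠ 0 := by
    rw [← hmult]; exact_mod_cast rayMult_ne_zero h𝔟 hcop hN0 hN hNm
  have hN𝔪 : ((Ideal.absNorm 𝔪 : ℕ) : ℂ) ≠ 0 := by
    have : (0 : ℝ) < Ideal.absNorm 𝔪 := by
      exact_mod_cast Nat.pos_of_ne_zero (by rwa [ne_eq, Ideal.absNorm_eq_zero_iff])
    exact_mod_cast this.ne'
  have hd : ((Real.sqrt |(discr K : ℝ)| : ℝ) : ℂ) ≠ 0 := by
    exact_mod_cast (Real.sqrt_pos.mpr (abs_pos.mpr (Int.cast_ne_zero.mpr (discr_ne_zero K)))).ne'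
  have hc0 : ((NumberField.pieceCst K N : ℝ) : ℂ) ≠ 0 :=
    Complex.ofReal_ne_zero.mpr (NumberField.pieceCst_pos hN0).ne'
  have hA0 : NumberField.gammaFactorCP K ∅ (1 / 2) ≠ 0 :=
    NumberField.gammaFactorCP_ne_zero ∅ (by norm_num [Complex.div_ofNat_re])
  have hε : (NumberField.heckePairW K ∅ I 1 N).ε =
      ((((FractionalIdeal.absNorm (rayModulus K 𝔪 𝔟) : ℝ) * Real.sqrt |(discr K : ℝ)|)⁻¹ : ℝ) : ℂ) := by
    simp only [NumberField.heckePairW, Finset.card_empty, pow_zero, one_mul]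
    rfl
  have hnorm : FractionalIdeal.absNorm (rayModulus K 𝔪 𝔟) =
      (Ideal.absNorm 𝔪 : ℚ) * ((Ideal.absNorm 𝔟 : ℚ))⁻¹ := by
    rw [rayModulus, map_mul, map_inv₀, FractionalIdeal.coeIdeal_absNorm, FractionalIdeal.coeIdeal_absNorm]
  have hC1R : C 1 * R = ((h₀ : ℂ))⁻¹ * ((2 : ℂ) ^ Fintype.card {w : InfinitePlace K // IsReal w})⁻¹ *
      (2 * ((((Ideal.absNorm 𝔪 : ℝ) * Real.sqrt |(discr K : ℝ)|)⁻¹ : ℝ) : ℂ) *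
        ((((NumberField.pieceCst K N : ℝ) : ℂ))⁻¹ * (NumberField.gammaFactorCP K ∅ (1 / 2))⁻¹)) := by
    rw [hC, hR]
    dsimp only
    rw [Complex.cpow_neg_one, hmult, hε, hnorm]
    push_cast
    field_simp
  -- assemble
  have hsum : ∑ p : Finset {w : InfinitePlace K // IsReal w},
      (NumberField.pieceDirichlet K p 1 (rayModulus K 𝔪 𝔟) 1 N s -
        NumberField.pieceDirichlet K p (-1) (rayModulus K 𝔪 𝔟) 1 N s) =
      ∑ p : Finset {w : InfinitePlace K // IsReal w},
        NumberField.signedCosetSum K p (I : FractionalIdeal (𝓞 K)⁰ K) 1 N s :=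
    rfl
  have hCs : C s = ((rayMult h𝔟 hcop N : ℂ))⁻¹ *
    ((2 : ℂ) ^ Fintype.card {w : InfinitePlace K // IsReal w})⁻¹ * ((Ideal.absNorm 𝔟 : ℕ) : ℂ) ^ (-s) := rfl
  rw [rayClassPartialZeta_eq_sum_pieceDirichlet h𝔟 hcop hN0 hN hNm hs, hsum, hEs s hs, ← hCs, ← hC1R]
  dsimp only
  rw [dslope_of_ne _ hs1, slope_def_field]
  field_simp
  ring

/-! ### Hecke's theorem: `L(χ, s)` is entire for `χ ≠ 1` -/

/-- **Hecke (1917): the L-series of a non-principal ray class character is entire** (Neukirch VII (8.5)–(8.6)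
with Remark 1 and §5 p. 473: "If `χ ≠ 1`, then `Z(χ, s)` is holomorphic on all of `ℂ`, as `Σ_𝔎 χ(𝔎) = 0`").
For `𝔪 ≠ 0` and a ray class character `χ mod 𝔪` (`IsRayClassCharacter 𝔪 ψ`) with `χ(𝔭) ≠ 1` for some prime
`𝔭 ∤ 𝔪`, there is an entire `L` with `L(s) = L(χ, s)` (`rayClassLSeries 𝔪 ψ s`) for `Re(s) > 1`:
`exists_rayClassPartialZeta_eq_add_div` with the orthogonality argument
`exists_differentiable_eq_rayClassLSeries_of_partialZeta` of `RayClassOrthogonality.lean`.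
[cite: NeukirchANT1999, Ch. VII §8 Thm. (8.5), Cor. (8.6) and Remark 1; §5 p. 473] -/
theorem exists_differentiable_eq_rayClassLSeries {𝔪 : Ideal (𝓞 K)} (h𝔪 : 𝔪 ≠ ⊥)
    {ψ : HeightOneSpectrum (𝓞 K) → ℂ} (hψ : IsRayClassCharacter 𝔪 ψ)
    (hnt : ∃ v : HeightOneSpectrum (𝓞 K), ¬ 𝔪 ≤ v.asIdeal ∧ ψ v ≠ 1) :
    ∃ L : ℂ → ℂ, Differentiable ℂ L ∧ ∀ s : ℂ, 1 < s.re → L s = rayClassLSeries 𝔪 ψ s := by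
  obtain ⟨ρ, hρ⟩ := exists_rayClassPartialZeta_eq_add_div h𝔪
  exact exists_differentiable_eq_rayClassLSeries_of_partialZeta h𝔪 hρ hψ hnt

end Literature.NumberTheory.LFunctions
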